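import Summits.QuantumFields.BalabanUV.T4Continuum.Support.CovariantMeanPaidSupply
import Summits.QuantumFields.BalabanUV.T4Continuum.Support.CovariantMeanFlatDatum

/-!
# `T4Continuum.CovariantMeanWitness` (cell-tree module `Summits/QuantumFields/BalabanUV/T4Continuum/Support/CovariantMeanWitness.lean`)
# — road P4 of the spine estimate NE1′: a NON-VACUITY WITNESS of the slot structures `StepSupply` / `PaidStepSupply` over a
# NON-EMPTY term representation with a NON-EMPTY fibre and a genuinely mean-zero pairing, on the flat datum
# (cell `pub-balaban`, scoping sub-cell `t4`, ROUND-2 prover seat #4 of BINDER-OWNERS row NE1′, unit `b2b-balaban-t4-ne1p-p4`,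
# generation 1; answers the referee's trigger condition for road P4 in `t4/b2b-balaban-t4-ref2/ref-pass60.md` («non-vacuity
# witness of `StepSupply` over a non-empty `TermRep`»); ADDITIVE — a new leaf importing `Support/CovariantMeanPaidSupply` and
# `Support/CovariantMeanFlatDatum`; nothing modified)

HONEST FRAMING.  Finite four-torus, rung (B)+1 only.  NOT infinite volume, NOT a mass gap, NOT the Clay problem, NOT summit
progress.  HONEST DEPENDENCY: continuum YM on T⁴ ⇐ BetaPertH ∧ nine spine estimates (0/9 proved); BetaPertH ⇐ (D1) ∧ (D4) ∧
CAP+tail; G-an2-4 gates asym, D1 and NE2/3/4.  WHAT THIS IS: evidence about the TYPES — the binder sets of `StepSupply`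
(p207717) and `PaidStepSupply` (p207989) are JOINTLY INHABITED by explicit terms: the one-term (0.3)-representation
`flatTermRep` of the flat datum's step `k = 0` of the run `K = 1`, `g₀ = 0` (piece `= Tρ₀ ≡ 1`, self-partnered, fibre `{bond₀}`
— NON-EMPTY; (0.3) holds for `R = id` because a term renormalised by itself is unchanged, the denominators being `= 1`), the
split `flatSplit` with ONE pairing (`Ω ≡ 1`, shift `S(V) = clampTr (V bond₀) − clampTr (V b₁)`, bounded by `2`, of MEAN ZERO
under the fibre mass by the EXCHANGE symmetry of product Haar — `integral_oddShift`, from `AveragingRT.measurePreserving_eval`),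
the factors `flatFactors` (ratios `1/4 < 1`), and the ladder `N j = 2·(1/2)^j` with one block of rate `1/2`.  WHAT IT IS NOT:
evidence about Bałaban's densities, about (B), or about the road's open leaf L8 — at `β = 0` every defect vanishes
(`covSize_flatSplit`, `remSize_flatSplit`) and the ladder is a free choice; (B) fails for the flat datum
(`CovariantMeanFlatDatum.not_endStatementBPrinted_flatData`).

CITATION HEADER (lean-in-tree rule).  No page of T. Bałaban's series or of any other source was newly read for this module and
nothing printed is asserted.  Objects re-used BY NAME: `CovariantMeanFlatDatum.flatData` / `flatData_Trho_zero` / `flatData_R` /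
`rho_flatData_zero` (this road), `AveragingRT.measurePreserving_eval` / `integrable_of_abs_le`, `B15.BasicStep.fibreIntegral` /
`normTerm` / `RopReal`, `T4ObservableTelescope.TermProvisos`, `T4UniformDefectWiring.TermRep` / `loopPullback`,
`T4ExteriorCovariance.CovSplit` / `covSize` / `remSize` / `foRem` / `cmGap` / `StepCovBudget`, `RegularGaugeGroup.measurable_reTr`,
and this road's `Factors` / `StepSupply` / `PaidStepSupply` / `PaidStepSupply.stepCovBudget`.  Every declaration is [folklore]
and sorry-free.  ABSOLUTE RULE honoured.
-/

noncomputable section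

open MeasureTheory Filter Topology Metric Set
open scoped BigOperators

namespace Summit.QuantumFields.BalabanUV.T4Continuum.CovariantMeanContraction

open Literature.MathematicalPhysics.QuantumFieldTheory.Balaban1983to89
open T4Continuum T4ExteriorCovariance T4SummableDefect T4ObservableTelescopeTwoRun T4UniformDefectWiring T4ObservableTelescope
  T4Spectator B15.BasicStep Missing T4FiniteEpsInhabited AveragingRT

/-! ## §1 The one-term representation, the exchange-odd split, and the witnesses -/

section Witness

variable (F : T4Family) (G : Type) [GaugeGroup G] [MeasurableSpace G] [HaarData G] [RegularGaugeGroup G]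
variable [∀ K j : ℕ, DecidableEq (PBond (F.P K) j)]

omit [RegularGaugeGroup G] in
/-- The fibre integral of a nonnegative constant over a one-bond fibre is the constant (normalised Haar). [folklore] -/
theorem fibreIntegral_const_singleton {P : Params} {j : ℕ} [DecidableEq (PBond P j)] (b : PBond P j) {c : ℝ} (hc : 0 ≤ c)
    (V : GaugeField P j G) : fibreIntegral {b} (fun _ => c) V = c := by
  unfold fibreIntegral
  rw [lmarginal_singleton]
  simp [lintegral_const, measure_univ, ENNReal.toReal_ofReal hc]

/-- A reference bond of `T^{(1)}` of the first torus (base site, first direction — `d ≥ 1`). [folklore] -/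
def bond₀ : PBond (F.P 1) 1 := ⟨default, ⟨0, (F.P 1).hd⟩⟩

/-- THE ONE-TERM REPRESENTATION OF THE FLAT STEP `k = 0` of the run `K = 1` at `g₀ = 0`: one term `Z = ()`, piece `= Tρ₀ ≡ 1`,
self-partnered, fibre `{bond₀}` (NON-EMPTY); (0.3) holds for `R = id` because a term renormalised by itself is unchanged
(`∫⌈_{Z′}ρ / ∫⌈_{Z′}ρ = 1`, the denominators being `= 1 ≠ 0`). [folklore] -/
def flatTermRep : TermRep ((flatData F G).real.Trho 1 0 0) ((flatData F G).real.R 1 0 0) where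
  ι := Unit
  piece := fun _ => (flatData F G).real.Trho 1 0 0
  pp := id
  fib := fun _ => {bond₀ F}
  bound := fun _ => 1
  provisos := fun _ => by
    rw [flatData_Trho_zero]
    exact { ins_meas := measurable_const, old_meas := measurable_const, ins_nonneg := fun _ => zero_le_one,
            old_nonneg := fun _ => zero_le_one, ins_le := fun _ => le_rfl, old_le := fun _ => le_rfl,
            den_ne := fun V => by rw [fibreIntegral_const_singleton G (bond₀ F) zero_le_one V]; exact one_ne_zero }
  sum_eq := fun V => by simp
  rop_eq := by
    rw [flatData_R, flatData_Trho_zero]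
    funext V
    simp only [id, RopReal, normTerm, Finset.univ_unique, Finset.sum_singleton]
    rw [fibreIntegral_const_singleton G (bond₀ F) zero_le_one V, div_one, mul_one]

/-- The flat representation's fields, by name. [folklore] -/
@[simp] theorem flatTermRep_fib (Z : (flatTermRep F G).ι) : (flatTermRep F G).fib Z = {bond₀ F} := rfl

/-- [folklore] -/
@[simp] theorem flatTermRep_pp (Z : (flatTermRep F G).ι) : (flatTermRep F G).pp Z = Z := rfl

/-- [folklore] -/
theorem flatTermRep_piece (Z : (flatTermRep F G).ι) : (flatTermRep F G).piece Z = fun _ => 1 :=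
  flatData_Trho_zero F G 1 0

/-- The term type of the flat representation is `Unit`: one term. [folklore] -/
instance flatTermRep_unique : Unique (flatTermRep F G).ι := inferInstanceAs (Unique Unit)

/-- The term type of the flat representation is inhabited and its fibre is non-empty. [folklore] -/
theorem flatTermRep_nonempty : Nonempty (flatTermRep F G).ι ∧ ∀ Z, ((flatTermRep F G).fib Z).Nonempty :=
  ⟨⟨default⟩, fun _ => Finset.singleton_nonempty _⟩

/-- The fibre mass of the flat term is the constant `1`. [folklore] -/
theorem fibreIntegral_flat (Z : (flatTermRep F G).ι) (V : GaugeField (F.P 1) 1 G) :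
    fibreIntegral ((flatTermRep F G).fib Z) ((flatTermRep F G).piece Z) V = 1 := by
  rw [flatTermRep_fib, flatTermRep_piece, fibreIntegral_const_singleton G (bond₀ F) zero_le_one V]

/-- The flat term's mass is `1`. [folklore] -/
theorem integral_flat_piece (Z : (flatTermRep F G).ι) :
    ∫ V, (flatTermRep F G).piece Z V ∂fieldMeasure (F.P 1) 1 G = 1 := by
  rw [flatTermRep_piece]; simp

omit [∀ K j : ℕ, DecidableEq (PBond (F.P K) j)] in
/-- The flat run's final mass is `1`. [folklore] -/
theorem integral_flat_rho :
    ∫ V, rho (flatData F G) 1 0 1 V ∂fieldMeasure (F.P 1) 1 G = 1 := by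
  rw [rho_flatData_zero]; simp

/-- A bounded measurable test function on the group: the real trace clamped to `[-1, 1]`. [folklore] -/
def clampTr : G → ℝ := fun g => max (-1) (min 1 (GaugeGroup.reTr g))

omit [HaarData G] [∀ K j : ℕ, DecidableEq (PBond (F.P K) j)] in
/-- `clampTr` is measurable. [folklore] -/
theorem measurable_clampTr : Measurable (clampTr G) :=
  measurable_const.max (measurable_const.min RegularGaugeGroup.measurable_reTr)

omit [MeasurableSpace G] [HaarData G] [RegularGaugeGroup G] [∀ K j : ℕ, DecidableEq (PBond (F.P K) j)] in
/-- `|clampTr| ≤ 1`. [folklore] -/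
theorem abs_clampTr_le (g : G) : |clampTr G g| ≤ 1 := by
  unfold clampTr
  rw [abs_le]
  exact ⟨le_max_left _ _, max_le (by norm_num) (min_le_left _ _)⟩

omit [RegularGaugeGroup G] [∀ K j : ℕ, DecidableEq (PBond (F.P K) j)] in
/-- The integral of a function of ONE bond variable against product Haar is its Haar integral. [folklore] -/
theorem integral_eval_eq {P : Params} {j : ℕ} (b : PBond P j) {φ : G → ℝ} (hφ : Measurable φ) :
    ∫ V, φ (V b) ∂fieldMeasure P j G = ∫ g, φ g ∂(HaarData.haar : Measure G) := by
  have hmp := AveragingRT.measurePreserving_eval (P := P) (j := j) (G := G) b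
  have key := integral_map (μ := fieldMeasure P j G) (φ := fun U : GaugeField P j G => U b)
    hmp.measurable.aemeasurable (hφ.aestronglyMeasurable (μ := _))
  rw [hmp.map_eq] at key
  exact key.symm

/-- The exchange-odd shift `S(V) = clampTr (V bond₀) − clampTr (V b₁)`. [folklore] -/
def oddShift (b₁ : PBond (F.P 1) 1) : GaugeField (F.P 1) 1 G → ℝ :=
  fun V => clampTr G (V (bond₀ F)) - clampTr G (V b₁)

omit [∀ K j : ℕ, DecidableEq (PBond (F.P K) j)] in
/-- The shift is measurable. [folklore] -/
theorem measurable_oddShift (b₁ : PBond (F.P 1) 1) : Measurable (oddShift F G b₁) :=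
  ((measurable_clampTr G).comp (AveragingRT.measurePreserving_eval (bond₀ F)).measurable).sub
    ((measurable_clampTr G).comp (AveragingRT.measurePreserving_eval b₁).measurable)

omit [MeasurableSpace G] [HaarData G] [RegularGaugeGroup G] [∀ K j : ℕ, DecidableEq (PBond (F.P K) j)] in
/-- The shift is bounded by `2`. [folklore] -/
theorem abs_oddShift_le (b₁ : PBond (F.P 1) 1) (V : GaugeField (F.P 1) 1 G) : |oddShift F G b₁ V| ≤ 2 := by
  have h1 := abs_clampTr_le G (V (bond₀ F))
  have h2 := abs_clampTr_le G (V b₁)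
  unfold oddShift
  calc |clampTr G (V (bond₀ F)) - clampTr G (V b₁)| ≤ |clampTr G (V (bond₀ F))| + |clampTr G (V b₁)| := abs_sub _ _
    _ ≤ 2 := by linarith

omit [∀ K j : ℕ, DecidableEq (PBond (F.P K) j)] in
/-- THE SHIFT HAS MEAN ZERO under product Haar, by the EXCHANGE symmetry (the two one-bond integrals coincide). [folklore] -/
theorem integral_oddShift (b₁ : PBond (F.P 1) 1) : ∫ V, oddShift F G b₁ V ∂fieldMeasure (F.P 1) 1 G = 0 := by
  have i1 : Integrable (fun V : GaugeField (F.P 1) 1 G => clampTr G (V (bond₀ F))) (fieldMeasure (F.P 1) 1 G) :=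
    AveragingRT.integrable_of_abs_le ((measurable_clampTr G).comp (AveragingRT.measurePreserving_eval (bond₀ F)).measurable)
      1 (fun V => abs_clampTr_le G _)
  have i2 : Integrable (fun V : GaugeField (F.P 1) 1 G => clampTr G (V b₁)) (fieldMeasure (F.P 1) 1 G) :=
    AveragingRT.integrable_of_abs_le ((measurable_clampTr G).comp (AveragingRT.measurePreserving_eval b₁).measurable)
      1 (fun V => abs_clampTr_le G _)
  unfold oddShift
  rw [integral_sub i1 i2, integral_eval_eq G (bond₀ F) (measurable_clampTr G), integral_eval_eq G b₁ (measurable_clampTr G),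
    sub_self]

/-- THE EXCHANGE-ODD SPLIT of the flat term's gap for any weight `g`: ONE pairing, sensitivity `Ω ≡ 1`, shift `oddShift b₁` —
bounded by `2`, of MEAN ZERO under the term's fibre mass (`≡ 1`) by the exchange symmetry of product Haar; no property of
Bałaban's laws is used or claimed. [folklore] -/
def flatSplit (Z : (flatTermRep F G).ι) (b₁ : PBond (F.P 1) 1) (g : GaugeField (F.P 1) 1 G → ℝ) :
    CovSplit ((flatTermRep F G).fib Z) ((flatTermRep F G).piece ((flatTermRep F G).pp Z)) ((flatTermRep F G).piece Z) g where
  κ := Unit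
  Ω := fun _ _ => 1
  S := fun _ => oddShift F G b₁
  Ω_meas := fun _ => measurable_const
  S_meas := fun _ => measurable_oddShift F G b₁
  θ := 1
  d := 2
  Ω_le := fun _ _ => by simp
  S_le := fun _ V => abs_oddShift_le F G b₁ V
  mean_zero := fun _ => by
    simp only [fibreIntegral_flat, one_mul]
    exact integral_oddShift F G b₁

/-- The split's fields, by name. [folklore] -/
@[simp] theorem flatSplit_Ω (Z : (flatTermRep F G).ι) (b₁ : PBond (F.P 1) 1) (g : GaugeField (F.P 1) 1 G → ℝ)
    (i : (flatSplit F G Z b₁ g).κ) (V : GaugeField (F.P 1) 1 G) : (flatSplit F G Z b₁ g).Ω i V = 1 := rfl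

/-- [folklore] -/
@[simp] theorem flatSplit_S (Z : (flatTermRep F G).ι) (b₁ : PBond (F.P 1) 1) (g : GaugeField (F.P 1) 1 G → ℝ)
    (i : (flatSplit F G Z b₁ g).κ) : (flatSplit F G Z b₁ g).S i = oddShift F G b₁ := rfl

/-- [folklore] -/
@[simp] theorem flatSplit_θ (Z : (flatTermRep F G).ι) (b₁ : PBond (F.P 1) 1) (g : GaugeField (F.P 1) 1 G → ℝ) :
    (flatSplit F G Z b₁ g).θ = 1 := rfl

/-- [folklore] -/
@[simp] theorem flatSplit_d (Z : (flatTermRep F G).ι) (b₁ : PBond (F.P 1) 1) (g : GaugeField (F.P 1) 1 G → ℝ) :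
    (flatSplit F G Z b₁ g).d = 2 := rfl

/-- One pairing. [folklore] -/
instance flatSplit_unique (Z : (flatTermRep F G).ι) (b₁ : PBond (F.P 1) 1) (g : GaugeField (F.P 1) 1 G → ℝ) :
    Unique (flatSplit F G Z b₁ g).κ := inferInstanceAs (Unique Unit)

/-- Every flat pairing integral vanishes. [folklore] -/
theorem integral_flat_pairing (Z : (flatTermRep F G).ι) (b₁ : PBond (F.P 1) 1) (g : GaugeField (F.P 1) 1 G → ℝ)
    (i : (flatSplit F G Z b₁ g).κ) :
    ∫ V, fibreIntegral ((flatTermRep F G).fib Z) ((flatTermRep F G).piece Z) V *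
      ((flatSplit F G Z b₁ g).Ω i V * (flatSplit F G Z b₁ g).S i V) ∂fieldMeasure (F.P 1) 1 G = 0 := by
  simp only [fibreIntegral_flat, flatSplit_Ω, flatSplit_S, one_mul]
  exact integral_oddShift F G b₁

/-- The flat term's covariance size vanishes. [folklore] -/
theorem covSize_flatSplit (Z : (flatTermRep F G).ι) (b₁ : PBond (F.P 1) 1) (g : GaugeField (F.P 1) 1 G → ℝ) :
    (flatSplit F G Z b₁ g).covSize = 0 := by
  unfold CovSplit.covSize
  rw [Fintype.sum_unique, integral_flat_pairing, abs_zero]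

/-- The flat term's remainder size vanishes (the gap of a term renormalised by itself is `0`, and the pairing has mean `0`).
[folklore] -/
theorem remSize_flatSplit (Z : (flatTermRep F G).ι) (b₁ : PBond (F.P 1) 1) (g : GaugeField (F.P 1) 1 G → ℝ) :
    (flatSplit F G Z b₁ g).remSize = 0 := by
  have hfo : ∀ V, foRem ((flatTermRep F G).fib Z) ((flatTermRep F G).piece ((flatTermRep F G).pp Z)) ((flatTermRep F G).piece Z)
      g (flatSplit F G Z b₁ g).Ω (flatSplit F G Z b₁ g).S V = - oddShift F G b₁ V := fun V => by
    unfold foRem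
    rw [Fintype.sum_unique, flatSplit_Ω, flatSplit_S, one_mul, flatTermRep_pp, cmGap, sub_self, zero_sub]
  have h2 : (fun V => fibreIntegral ((flatTermRep F G).fib Z) ((flatTermRep F G).piece Z) V *
      foRem ((flatTermRep F G).fib Z) ((flatTermRep F G).piece ((flatTermRep F G).pp Z)) ((flatTermRep F G).piece Z)
        g (flatSplit F G Z b₁ g).Ω (flatSplit F G Z b₁ g).S V) = fun V => - oddShift F G b₁ V := by
    funext V; rw [hfo, fibreIntegral_flat, one_mul]
  have key : ∫ V, fibreIntegral ((flatTermRep F G).fib Z) ((flatTermRep F G).piece Z) V *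
      foRem ((flatTermRep F G).fib Z) ((flatTermRep F G).piece ((flatTermRep F G).pp Z)) ((flatTermRep F G).piece Z)
        g (flatSplit F G Z b₁ g).Ω (flatSplit F G Z b₁ g).S V ∂fieldMeasure (F.P 1) 1 G = 0 := by
    rw [h2, integral_neg]
    exact neg_eq_zero.mpr (integral_oddShift F G b₁)
  unfold CovSplit.remSize
  exact (congrArg (fun x : ℝ => |x|) key).trans abs_zero

/-- THE WITNESS FACTORS: `cnt = 2`, `Λ₄ = 1`, `θ₁ = ρ = 1/2`, `w ≡ wbar = 1`, all constants `1`; ratios `1/4 < 1`. [folklore] -/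
def flatFactors : Factors where
  cnt := 2
  Λ₄ := 1
  θ₁ := 1 / 2
  w := fun _ => 1
  wbar := 1
  Csens := 1
  Cprop := 1
  ρ := 1 / 2
  Cfin := 1
  C₂ := 1
  cnt_nonneg := by norm_num
  Λ₄_nonneg := by norm_num
  θ₁_nonneg := by norm_num
  w_nonneg := fun _ => by norm_num
  w_le := fun _ => le_rfl
  Csens_nonneg := by norm_num
  Cprop_nonneg := by norm_num
  ρ_nonneg := by norm_num
  Cfin_nonneg := by norm_num
  C₂_nonneg := by norm_num
  ratio₁_lt_one := by norm_num
  ratio₂_lt_one := by norm_num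

/-- **THE PAID WITNESS**: a `PaidStepSupply` of the flat datum's step `k = 0` at distance `n = 0` (run `K = 1`, `g₀ = 0`, any
loop string), over the one-term representation with fibre `{bond₀}` and the exchange-odd split; ladder `N j = 2·(1/2)^j`, one
block of rate `1/2`. [folklore] -/
def flatPaidStepSupply (b₁ : PBond (F.P 1) 1) (Cs : List (ULoop F)) :
    PaidStepSupply (flatData F G) (fun _ => 0) Cs flatFactors 0 0 where
  ρr := flatTermRep F G
  cs := fun Z => flatSplit F G Z b₁ _
  massCount₁ := by
    rw [Fintype.sum_unique, flatSplit_d, flatTermRep_fib, Finset.card_singleton]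
    have h1 := integral_flat_piece F G (default : (flatTermRep F G).ι)
    have h2 := integral_flat_rho F G
    change (∫ V, (flatTermRep F G).piece default V ∂fieldMeasure (F.P 1) 1 G) * ((1 : ℕ) : ℝ) * 2
      ≤ 2 * 1 ^ 0 * 1 * ∫ V, rho (flatData F G) 1 0 1 V ∂fieldMeasure (F.P 1) 1 G
    rw [h1, h2]; norm_num
  massCount₂ := by
    rw [Fintype.sum_unique, flatTermRep_fib, Finset.card_singleton]
    have h1 := integral_flat_piece F G (default : (flatTermRep F G).ι)
    have h2 := integral_flat_rho F G
    change (∫ V, (flatTermRep F G).piece default V ∂fieldMeasure (F.P 1) 1 G) * ((1 : ℕ) : ℝ) ^ 2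
      ≤ 2 * 1 ^ 0 * 1 * ∫ V, rho (flatData F G) 1 0 1 V ∂fieldMeasure (F.P 1) 1 G
    rw [h1, h2]; norm_num
  sens := fun Z => by
    have hc : ((flatTermRep F G).fib Z).card = 1 := by rw [flatTermRep_fib, Finset.card_singleton]
    rw [flatSplit_θ, hc, Fintype.card_unique]
    change ((1 : ℕ) : ℝ) * 1 ≤ 1 * (1 / 2) ^ 0 * ((1 : ℕ) : ℝ)
    norm_num
  rem := fun Z => by
    rw [remSize_flatSplit, flatTermRep_fib, Finset.card_singleton]
    have h1 := integral_flat_piece F G Z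
    change (0 : ℝ) ≤ (∫ V, (flatTermRep F G).piece Z V ∂fieldMeasure (F.P 1) 1 G) * (1 * ((1 / 2 : ℝ) ^ 0) ^ 2 * ((1 : ℕ) : ℝ) ^ 2)
    rw [h1]; norm_num
  J := 1
  N := fun _ _ j => 2 * (1 / 2 : ℝ) ^ j
  κb := fun _ => 1 / 2
  d_nonneg := fun Z => by rw [flatSplit_d]; norm_num
  κb_nonneg := fun _ => by norm_num
  birth := fun Z _ => by rw [flatSplit_d]; norm_num
  contract := fun _ _ j => by rw [pow_succ]; ring_nf; exact le_rfl
  rate := by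
    change ∏ j ∈ Finset.range 1, (1 / 2 : ℝ) ≤ 1 * (1 / 2) ^ 0
    norm_num
  final := fun Z i => by
    rw [integral_flat_pairing, abs_zero, flatSplit_θ]
    have h1 := integral_flat_piece F G Z
    change (0 : ℝ) ≤ 1 * (∫ V, (flatTermRep F G).piece Z V ∂fieldMeasure (F.P 1) 1 G) * (2 * (1 / 2 : ℝ) ^ 1) * 1
    rw [h1]; norm_num

/-- **THE TERM-UNIFORM WITNESS**: the same data inhabit `StepSupply` (p207717). [folklore] -/
def flatStepSupply (b₁ : PBond (F.P 1) 1) (Cs : List (ULoop F)) :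
    StepSupply (flatData F G) (fun _ => 0) Cs flatFactors 0 0 where
  ρr := flatTermRep F G
  cs := fun Z => flatSplit F G Z b₁ _
  massCount := (flatPaidStepSupply F G b₁ Cs).massCount₂
  sens := (flatPaidStepSupply F G b₁ Cs).sens
  rem := (flatPaidStepSupply F G b₁ Cs).rem
  J := 1
  N := fun _ _ j => 2 * (1 / 2 : ℝ) ^ j
  κb := fun _ => 1 / 2
  κb_nonneg := fun _ => by norm_num
  birth := fun Z _ => by rw [flatSplit_d]; norm_num
  contract := fun _ _ j => by rw [pow_succ]; ring_nf; exact le_rfl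
  rate := fun Z => by
    rw [flatSplit_d]
    change (2 : ℝ) * ∏ j ∈ Finset.range 1, (1 / 2 : ℝ) ≤ 1 * (1 / 2) ^ 0
    norm_num
  final := (flatPaidStepSupply F G b₁ Cs).final

/-- **NON-VACUITY OF THE PAID SLOTS** over a non-empty term representation with a non-empty fibre and one pairing whose shift is
genuinely mean-zero (and not identically zero as soon as `clampTr` separates two group elements and `b₁ ≠ bond₀`). [folklore] -/
theorem nonempty_paidStepSupply_flat (b₁ : PBond (F.P 1) 1) (Cs : List (ULoop F)) :
    ∃ σ : PaidStepSupply (flatData F G) (fun _ => 0) Cs flatFactors 0 0,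
      Nonempty σ.ρr.ι ∧ (∀ Z, (σ.ρr.fib Z).Nonempty) ∧ ∀ Z, Nonempty (σ.cs Z).κ :=
  ⟨flatPaidStepSupply F G b₁ Cs, ⟨(default : (flatTermRep F G).ι)⟩, fun _ => Finset.singleton_nonempty _,
    fun _ => ⟨(default : Unit)⟩⟩

/-- **NON-VACUITY OF THE SLOTS** (`StepSupply`, p207717) — the referee's wording (`t4/b2b-balaban-t4-ref2/ref-pass60.md`).
[folklore] -/
theorem nonempty_stepSupply_flat (b₁ : PBond (F.P 1) 1) (Cs : List (ULoop F)) :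
    ∃ σ : StepSupply (flatData F G) (fun _ => 0) Cs flatFactors 0 0,
      Nonempty σ.ρr.ι ∧ (∀ Z, (σ.ρr.fib Z).Nonempty) ∧ ∀ Z, Nonempty (σ.cs Z).κ :=
  ⟨flatStepSupply F G b₁ Cs, ⟨(default : (flatTermRep F G).ι)⟩, fun _ => Finset.singleton_nonempty _,
    fun _ => ⟨(default : Unit)⟩⟩

/-- Hence the lane's step datum is inhabited at the flat step with the road's budget: the shapes are consistent with the
carriers. [folklore] -/
theorem stepCovBudget_flat (b₁ : PBond (F.P 1) 1) (Cs : List (ULoop F)) :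
    StepCovBudget (flatData F G) (fun _ => 0) Cs (flatFactors.budget 0) 0 0 :=
  (flatPaidStepSupply F G b₁ Cs).stepCovBudget

end Witness

end Summit.QuantumFields.BalabanUV.T4Continuum.CovariantMeanContraction
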